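import Summits.NavierStokesRegularity.NavierStokesRegularity.Theses.QuantisedSymmetry
import Summits.NavierStokesRegularity.NavierStokesRegularity.Theses.Blowup
import Summits.NavierStokesRegularity.NavierStokesRegularity.Theorems.QuantisedSymmetryPolyhedralDssProfileExistsDominatesBlowupProfile
import Summits.NavierStokesRegularity.NavierStokesRegularity.Theorems.QuantisedSymmetryPolyhedralTruncationBridge
import Summits.NavierStokesRegularity.NavierStokesRegularity.Theorems.QuantisedSymmetryPolyhedralDssProfileExistsStubPeriodWindow
import Literature.Analysis.FluidPDE.SelfSimilarLiouville
import Literature.Analysis.FluidPDE.ForwardRDSSExistence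
import HarnessLib

/-!
# Strategist sketch `s18` (gen 9, census family `s`, independent) — typed statements behind
`Cruxes/PolyhedralDssProfileExists/STRATEGY-CENSUS-s18.md`

Crux: `Theses.QuantisedSymmetry.PolyhedralDssProfileExists` (stmt-NavierStokesRegularity-1404, X⁻).
Every `def` below is a `Prop` the census discusses; every `theorem` is a kernel-checked relation
between them and in-tree theorems (no `sorry`).  Sections follow the census headings:

* §W  weaker intermediates (what strictly-weaker statement could replace the crux on the path to ¬S);
* §D  decompositions (k ≥ 2 pieces with a proved assembly; which piece is the crux again);
* §S  strengthenings;
* §N  negation-side by-products (they belong to the kill switch stmt-1405, not to X⁻);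
* §T  transfer anchors (in-tree names of the sibling theorems the census cites).
-/

namespace Summit.NavierStokesRegularity.NavierStokesRegularity.Cruxes.PolyhedralDssProfileExists.S18g9

open MeasureTheory
open Literature.Analysis.FluidPDE

local notation "ℝ³" => EuclideanSpace ℝ (Fin 3)

/-! ### Shared predicates (the crux, unbundled) -/

/-- `G` is a finite irreducible group of proper rotations of `ℝ³` (the T/O/I data of the crux). -/
def IsPolyhedralGroup (G : Subgroup (ℝ³ ≃ₗᵢ[ℝ] ℝ³)) : Prop :=
  Finite G ∧ (∀ g ∈ G, LinearMap.det (g.toLinearEquiv : ℝ³ →ₗ[ℝ] ℝ³) = 1) ∧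
    ∀ V : Submodule ℝ ℝ³, (∀ g ∈ G, ∀ v ∈ V, g v ∈ V) → V = ⊥ ∨ V = ⊤

/-- `u` is `G`-equivariant about the origin on every time slice. -/
def IsEquivariant (G : Subgroup (ℝ³ ≃ₗᵢ[ℝ] ℝ³)) (u : ℝ → ℝ³ → ℝ³) : Prop :=
  ∀ g ∈ G, ∀ t x, u t (g x) = g (u t x)

/-- A **polyhedral cell**: a nontrivial `G`-equivariant Type-I `c`-DSS ancient mild solution (`ν = 1`). -/
def IsPolyhedralCell (G : Subgroup (ℝ³ ≃ₗᵢ[ℝ] ℝ³)) (c : ℝ) (u : ℝ → ℝ³ → ℝ³) : Prop :=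
  IsAncientMildSolution 1 u ∧ (∀ t < 0, AEStronglyMeasurable (u t) volume) ∧
    IsDiscretelySelfSimilar c u ∧ (∃ C₀ : ℝ, HasTypeIDecay C₀ u) ∧ IsEquivariant G u ∧
      ¬ (∀ t < 0, u t =ᵐ[volume] 0)

/-- The crux is literally "some polyhedral group, some factor `c > 1`, some polyhedral cell". -/
theorem crux_iff :
    Theses.QuantisedSymmetry.PolyhedralDssProfileExists ↔
      ∃ G, IsPolyhedralGroup G ∧ ∃ c : ℝ, 1 < c ∧ ∃ u, IsPolyhedralCell G c u := by
  unfold Theses.QuantisedSymmetry.PolyhedralDssProfileExists IsPolyhedralGroup IsPolyhedralCell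
    IsEquivariant
  constructor
  · rintro ⟨G, h1, h2, h3, rest⟩
    exact ⟨G, ⟨h1, h2, h3⟩, rest⟩
  · rintro ⟨G, ⟨h1, h2, h3⟩, rest⟩
    exact ⟨G, h1, h2, h3, rest⟩

/-! ### §W — weaker intermediates on the path X⁻ → ¬S

The chain  X⁻ ⇒ W2 ⇒ W1 (= stmt-0155)  and  X⁻ ⇒ W3 (= Blowup X5a) ⇒ ¬S  is kernel-checked below from
in-tree theorems; every station is itself a Type-I/finite-time BLOW-UP EXISTENCE statement. -/

/-- **W2** (group-free, rotation-free): some factor `c > 1` carries a nontrivial Type-I `c`-DSS ancient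
mild solution, i.e. Tsai's plain `λ`-DSS Liouville statement fails at some `λ`. -/
def SomeTypeIDssProfile : Prop := ∃ c : ℝ, 1 < c ∧ ¬ TypeIDSSLiouville c

/-- X⁻ ⇒ W2 (in tree: `exists_not_typeIDSSLiouville_of_polyhedralDssProfileExists`, lead c15). -/
theorem crux_imp_someTypeIDssProfile :
    Theses.QuantisedSymmetry.PolyhedralDssProfileExists → SomeTypeIDssProfile :=
  fun h => Theorems.PolyhedralDssProfileExists.PolyhedralCell.exists_not_typeIDSSLiouville_of_polyhedralDssProfileExists h

/-- W2 ⇒ W1 = `Blowup.BlowupTypeIDssProfile` (stmt-0155: the rotated-or-plain version). -/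
theorem someTypeIDssProfile_imp_blowupProfile :
    SomeTypeIDssProfile → Theses.Blowup.BlowupTypeIDssProfile := by
  rintro ⟨c, -, hc⟩
  dsimp only [Theses.Blowup.BlowupTypeIDssProfile]
  exact fun hL => hc (hL c).1

/-- X⁻ ⇒ W1 directly (in tree: `stub_dominatesBlowupProfile`). -/
theorem crux_imp_blowupProfile :
    Theses.QuantisedSymmetry.PolyhedralDssProfileExists → Theses.Blowup.BlowupTypeIDssProfile :=
  Theorems.PolyhedralDssProfileExists.PolyhedralCell.stub_dominatesBlowupProfile

/-- **W3**: X⁻ ⇒ `Blowup.BlowupExists` (X5a: a finite-lifespan Leray–Hopf classical solution from a rapidly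
decaying datum), by the PROVED sector-agnostic truncation bridge (stmt-11331). -/
theorem crux_imp_blowupExists :
    Theses.QuantisedSymmetry.PolyhedralDssProfileExists → Theses.Blowup.BlowupExists := by
  rintro ⟨G, hfin, hdet, hirr, c, hc, u, hanc, hmeas, hdss, hdec, heqv, hnt⟩
  exact Theorems.quantisedSymmetry_polyhedralTruncationBridge_proof G hfin hdet hirr c hc u hanc hmeas
    hdss hdec heqv hnt

/-- W3 ⇒ ¬S (route Blowup's deciding theorem with the discharged Clay uniqueness). -/
theorem blowupExists_imp_not_summit :
    Theses.Blowup.BlowupExists → ¬ _root_.NavierStokesRegularity :=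
  fun h => Theses.Blowup.closes h Theses.Blowup.BlowupClayUniqueness_holds

/-! ### §D — decompositions (assembly proved; the open piece named)

**D-A (existence scheme = non-collapsing approximate cells + compactness of cells).**  Approximate cells
are FORCED ancient mild solutions (the tree's duality identity carries a force slot) with all the exact
symmetries; `CompactnessOfCells` is a genuine lemma (Type-I bound ⇒ local Hölder compactness, the duality
identity, DSS, equivariance and the decay pass to locally uniform limits; non-collapse at a bounded point
keeps the limit nontrivial); `NonCollapsingApproximants` is implied by the crux (constant sequence, zero
force, the nontrivial slice rescaled into the fundamental window) — so modulo the compactness lemma it IS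
the crux: the whole difficulty of X⁻ is to produce approximate cells that do not collapse to `0`. -/

/-- Forced ancient mild solutions on `(-∞,0) × ℝ³` (`ν = 1`, force `f`): the crux's solution notion with the
force slot of `IsMildNSSolutionBetween` opened. -/
def IsForcedAncientMild (f u : ℝ → ℝ³ → ℝ³) : Prop :=
  (∀ t < 0, IsWeaklyDivFree (u t)) ∧ ∀ s t : ℝ, s < t → t < 0 → IsMildNSSolutionBetween 1 f u s t

/-- With zero force this is exactly `IsAncientMildSolution 1`. -/
theorem isForcedAncientMild_zero_iff (u : ℝ → ℝ³ → ℝ³) :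
    IsForcedAncientMild 0 u ↔ IsAncientMildSolution 1 u := Iff.rfl

/-- The data of an approximating family: symmetric forced cells `u n` with forces `f n → 0` in the
scale-invariant weighted norm, a common Type-I constant, and NON-COLLAPSE at a bounded point of the
fundamental time window `[-c², -1]`. -/
def IsApproximatingFamily (G : Subgroup (ℝ³ ≃ₗᵢ[ℝ] ℝ³)) (c C₀ δ : ℝ)
    (u f : ℕ → ℝ → ℝ³ → ℝ³) : Prop :=
  (∀ n, IsForcedAncientMild (f n) (u n) ∧ (∀ t < 0, AEStronglyMeasurable (u n t) volume) ∧
      IsDiscretelySelfSimilar c (u n) ∧ HasTypeIDecay C₀ (u n) ∧ IsEquivariant G (u n)) ∧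
    (∀ ε > 0, ∃ N : ℕ, ∀ n ≥ N, ∀ t < 0, ∀ x : ℝ³, ‖f n t x‖ ≤ ε / (‖x‖ + Real.sqrt (-t)) ^ 3) ∧
    (∀ n, ∃ t ∈ Set.Icc (-(c ^ 2)) (-1 : ℝ), ∃ x : ℝ³, ‖x‖ ≤ δ⁻¹ ∧ δ ≤ ‖u n t x‖)

/-- **Piece D-A.1 (open; = the crux in disguise):** a non-collapsing approximating family exists. -/
def NonCollapsingApproximants : Prop :=
  ∃ G, IsPolyhedralGroup G ∧ ∃ c : ℝ, 1 < c ∧ ∃ C₀ δ : ℝ, 0 < δ ∧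
    ∃ u f : ℕ → ℝ → ℝ³ → ℝ³, IsApproximatingFamily G c C₀ δ u f

/-- **Piece D-A.2 (a lemma, plausibly M/L):** compactness of symmetric Type-I forced cells. -/
def CompactnessOfCells : Prop :=
  ∀ G, IsPolyhedralGroup G → ∀ c : ℝ, 1 < c → ∀ C₀ δ : ℝ, 0 < δ →
    ∀ u f : ℕ → ℝ → ℝ³ → ℝ³, IsApproximatingFamily G c C₀ δ u f → ∃ v, IsPolyhedralCell G c v

/-- Assembly of D-A (proved): the two pieces give the crux. -/
theorem crux_of_DA (h1 : NonCollapsingApproximants) (h2 : CompactnessOfCells) :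
    Theses.QuantisedSymmetry.PolyhedralDssProfileExists := by
  obtain ⟨G, hG, c, hc, C₀, δ, hδ, u, f, hfam⟩ := h1
  obtain ⟨v, hv⟩ := h2 G hG c hc C₀ δ hδ u f hfam
  exact crux_iff.mpr ⟨G, hG, c, hc, v, hv⟩

/-! **D-D (θ-homotopy).**  The one-parameter family `∂ₛU = 𝓛U + θU − P(U·∇U)` in similarity variables is,
in physical variables, Navier–Stokes with the linear self-force `f = θ u/(−t)`; `θ = 0` is the crux's
equation.  Split: a branch of θ-cells with uniform constants down to `θ → 0⁺` (D-D.1) + closedness at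
`θ = 0` (D-D.2, compactness again).  D-D.1 is the crux relocated: for `0 < θ < ½` the trivial branch is
still isolated (𝓛 + θ ≤ θ − ½ < 0 on the Gaussian space; small cells are trivial), the first kernels
`θ ∈ (ℕ+1)/2` are Hermite POLYNOMIAL fields violating the Type-I decay, and in the Type-I class the far
field `|y|⁻¹` is neutral for 𝓛, so `0` sits in the essential spectrum — no Crandall–Rabinowitz point. -/

/-- The θ-self-force `θ u /(−t)`. -/
noncomputable def thetaForce (θ : ℝ) (u : ℝ → ℝ³ → ℝ³) : ℝ → ℝ³ → ℝ³ :=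
  fun t x => (θ / (-t)) • u t x

/-- A θ-cell: a nontrivial symmetric Type-I `c`-DSS ancient mild solution of NS forced by `θ u/(−t)`. -/
def IsThetaCell (G : Subgroup (ℝ³ ≃ₗᵢ[ℝ] ℝ³)) (θ c C₀ : ℝ) (u : ℝ → ℝ³ → ℝ³) : Prop :=
  IsForcedAncientMild (thetaForce θ u) u ∧ (∀ t < 0, AEStronglyMeasurable (u t) volume) ∧
    IsDiscretelySelfSimilar c u ∧ HasTypeIDecay C₀ u ∧ IsEquivariant G u ∧
      ¬ (∀ t < 0, u t =ᵐ[volume] 0)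

/-- At `θ = 0` a θ-cell is a polyhedral cell (with the named Type-I constant). -/
theorem isThetaCell_zero {G : Subgroup (ℝ³ ≃ₗᵢ[ℝ] ℝ³)} {c C₀ : ℝ} {u : ℝ → ℝ³ → ℝ³}
    (h : IsThetaCell G 0 c C₀ u) : IsPolyhedralCell G c u := by
  obtain ⟨hmild, hmeas, hdss, hdec, heqv, hnt⟩ := h
  have h0 : thetaForce 0 u = 0 := by
    funext t x
    simp [thetaForce]
  rw [h0] at hmild
  exact ⟨(isForcedAncientMild_zero_iff u).mp hmild, hmeas, hdss, ⟨C₀, hdec⟩, heqv, hnt⟩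

/-- **Piece D-D.1 (open; the crux relocated to θ > 0):** θ-cells for all small `θ > 0` with a common
Type-I constant and non-collapse in the fundamental window. -/
def ThetaBranchDownToZero : Prop :=
  ∃ G, IsPolyhedralGroup G ∧ ∃ c : ℝ, 1 < c ∧ ∃ C₀ δ : ℝ, 0 < δ ∧
    ∀ θ : ℝ, 0 < θ → θ < δ → ∃ u, IsThetaCell G θ c C₀ u ∧
      ∃ t ∈ Set.Icc (-(c ^ 2)) (-1 : ℝ), ∃ x : ℝ³, ‖x‖ ≤ δ⁻¹ ∧ δ ≤ ‖u t x‖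

/-- **Piece D-D.2 (a lemma):** closedness of symmetric Type-I cells as `θ → 0⁺`. -/
def ThetaClosedAtZero : Prop :=
  ∀ G, IsPolyhedralGroup G → ∀ c : ℝ, 1 < c → ∀ C₀ δ : ℝ, 0 < δ →
    (∀ θ : ℝ, 0 < θ → θ < δ → ∃ u, IsThetaCell G θ c C₀ u ∧
      ∃ t ∈ Set.Icc (-(c ^ 2)) (-1 : ℝ), ∃ x : ℝ³, ‖x‖ ≤ δ⁻¹ ∧ δ ≤ ‖u t x‖) →
    ∃ v, IsPolyhedralCell G c v

/-- Assembly of D-D (proved). -/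
theorem crux_of_DD (h1 : ThetaBranchDownToZero) (h2 : ThetaClosedAtZero) :
    Theses.QuantisedSymmetry.PolyhedralDssProfileExists := by
  obtain ⟨G, hG, c, hc, C₀, δ, hδ, hbranch⟩ := h1
  obtain ⟨v, hv⟩ := h2 G hG c hc C₀ δ hδ hbranch
  exact crux_iff.mpr ⟨G, hG, c, hc, v, hv⟩

/-! ### §S — strengthenings -/

/-- **S⁺₁ (for every Platonic sector):** every finite irreducible rotation group carries a cell. Gives the
crux as soon as one polyhedral group is exhibited (hypothesis `hG`). -/
def CruxForAllGroups : Prop :=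
  ∀ G, IsPolyhedralGroup G → ∃ c : ℝ, 1 < c ∧ ∃ u, IsPolyhedralCell G c u

theorem crux_of_forall (hG : ∃ G, IsPolyhedralGroup G) (h : CruxForAllGroups) :
    Theses.QuantisedSymmetry.PolyhedralDssProfileExists := by
  obtain ⟨G, hG⟩ := hG
  obtain ⟨c, hc, u, hu⟩ := h G hG
  exact crux_iff.mpr ⟨G, hG, c, hc, u, hu⟩

/-- **S⁺₂ (polyhedral scaling SOLITON, i.e. an RSS profile in a Platonic sector):** a nontrivial
`G`-equivariant Type-I ancient mild solution which is rotated self-similar with angular speed `α` about the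
`x₃`-axis (`IsRSS α`, Bradshaw–Tsai (v-RSS); `G` ranges over all conjugates, so fixing the axis loses
nothing).  REFUTABLE by symmetry alone plus Tsai 1998: for `α ≠ 0`, equivariance of every slice under
`G` and under `R(αs)⁻¹ G R(αs)` for all `s` forces `SO(3)`-equivariance (a closed subgroup of `SO(3)`
containing an irreducible finite group and non-identity elements near `1` is `SO(3)`), hence radial
divergence-free slices, hence `0`; for `α = 0` the field is self-similar, hence steady in similarity
variables, hence `0` (`tsai_selfsimilar_holds`).  So the Platonic sectors admit NO scaling solitons: the
crux necessarily asks for a breather (DSS), the class with the fewest tools. -/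
def PolyhedralRssProfileExists : Prop :=
  ∃ G, IsPolyhedralGroup G ∧ ∃ α : ℝ, ∃ u : ℝ → ℝ³ → ℝ³,
    IsAncientMildSolution 1 u ∧ (∀ t < 0, AEStronglyMeasurable (u t) volume) ∧ IsRSS α u ∧
      (∃ C₀ : ℝ, HasTypeIDecay C₀ u) ∧ IsEquivariant G u ∧ ¬ (∀ t < 0, u t =ᵐ[volume] 0)

/-- The Liouville statement refuting S⁺₂ (expected provable in tree, size M; not needed by any route). -/
def PolyhedralRssLiouville : Prop := ¬ PolyhedralRssProfileExists

/-! ### §N — negation-side by-products (they feed stmt-1405 `PolyhedralTypeILiouville`, DSS case)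

N-a: the near-steady window is IN TREE — `stub_periodWindow` (Chae–Wolf 2017 Thm 1.3 on the crux's own
variables; quantitative version Pineau–Vicol 2026 Thm 1.6).  N-b below is NEW (2026): "no slow phase". -/

/-- Anchor: the in-tree period window (cells have `c ≥ c₁(C₀) > 1`). -/
example : ∀ C₀ : ℝ, 0 < C₀ → ∃ c₁ : ℝ, 1 < c₁ ∧
    ∀ (c : ℝ) (u : ℝ → ℝ³ → ℝ³), 1 < c → c < c₁ →
      IsAncientMildSolution 1 u → (∀ t < 0, AEStronglyMeasurable (u t) volume) →
      IsDiscretelySelfSimilar c u → HasTypeIDecay C₀ u → ∀ t < 0, u t =ᵐ[volume] 0 :=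
  Theorems.PolyhedralDssProfileExists.PolyhedralCell.stub_periodWindow

/-- The self-similar time derivative in physical variables,
`D u (t,x) = (−t) ∂ₜu − ½ u − ½ (x·∇) u` (`= (−t)^{-1/2} ∂ₛU`, Pineau–Vicol (1.18)). -/
noncomputable def selfSimilarTimeDeriv (u : ℝ → ℝ³ → ℝ³) (t : ℝ) (x : ℝ³) : ℝ³ :=
  (-t) • deriv (fun τ => u τ x) t - (1 / 2 : ℝ) • u t x - (1 / 2 : ℝ) • (fderiv ℝ (u t) x) x

/-- **N-b "no slow phase"** (consequence of Pineau–Vicol arXiv:2607.09619 Thm 1.9 — in tree as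
`pineauVicol2026_oneSlice_regularity_holds` — plus periodicity in `s` and DSS rescaling): for every Type-I constant there is `δ > 0` such that a classical `c`-DSS
solution on `ℝ³ × (−∞,0)` with `|u| ≤ C₀/(|x|+√−t)`, `|p| ≤ C₀²/(|x|+√−t)²`, whose self-similar time
derivative is `δ`-small in `L∞` on ONE slice, vanishes.  Equivalently every DSS cell has
`‖∂ₛU(s)‖_{L∞} ≥ δ(C₀)` at EVERY phase — a necessary condition (N39) for the hunt, and the DSS case of a
quantitative step toward stmt-1405. -/
def NoSlowPhase : Prop :=
  ∀ C₀ : ℝ, 0 < C₀ → ∃ δ : ℝ, 0 < δ ∧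
    ∀ (c : ℝ) (u : ℝ → ℝ³ → ℝ³) (p : ℝ → ℝ³ → ℝ), 1 < c →
      IsClassicalNSSolutionOn (Set.Iio 0) 1 0 u p → IsDiscretelySelfSimilar c u → HasTypeIDecay C₀ u →
      (∀ t < 0, ∀ x : ℝ³, |p t x| ≤ C₀ ^ 2 / (‖x‖ + Real.sqrt (-t)) ^ 2) →
      (∃ t < 0, ∀ x : ℝ³, Real.sqrt (-t) * ‖selfSimilarTimeDeriv u t x‖ ≤ δ) →
      ∀ t < 0, ∀ x, u t x = 0

/-! ### §T — transfer anchors (in-tree names the census cites) -/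

example : Prop := chaeWolf2018_dss_existence          -- forward DSS existence (Chae–Wolf 2018)
example : Prop := bradshawTsai2019_dss_existence      -- forward DSS existence (Bradshaw–Tsai 2019)
example : Prop := tsai_selfsimilar                    -- backward SS Liouville (Tsai 1998)
example : Prop := necas_ruzicka_sverak                -- backward SS Liouville (NRŠ 1996)
example : chaeWolf2017_removing_dss := chaeWolf2017_removing_dss_holds   -- Chae–Wolf 2017 Thm 1.3, proved
example : knss2009_axisymmetric_no_swirl := knss2009_axisymmetric_no_swirl_holds  -- KNSS Thm 5.2, proved

end Summit.NavierStokesRegularity.NavierStokesRegularity.Cruxes.PolyhedralDssProfileExists.S18g9
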